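import Summits.BirchSwinnertonDyer.BirchSwinnertonDyer.Theorems.GenusKolyvaginAtTwoPowDvdShaCardAtTwoRTLocalEigenDuality
import Summits.BirchSwinnertonDyer.BirchSwinnertonDyer.Theorems.GenusKolyvaginAtTwoPowDvdShaCardAtTwoRTLocalConjInvariance
import Summits.BirchSwinnertonDyer.BirchSwinnertonDyer.Theorems.GenusKolyvaginAtTwoPowDvdShaCardAtTwoRTUnramifiedParametrization
import Summits.BirchSwinnertonDyer.BirchSwinnertonDyer.Theorems.GenusKolyvaginAtTwoPowDvdShaCardAtTwoRTRegularFrameAtTwo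
import HarnessLib

/-!
# Route `GenusKolyvaginAtTwo`, crux L_T `PowDvdShaCardAtTwoRT` (stmt-BirchSwinnertonDyer-23299, ex 23242), LINE 18, road (E4) for stub Deep —
# THE CROSS-SIGN LOCAL VANISHING AT A DEEP INERT KOLYVAGIN PLACE, MODULO `q`: a Kummer class that is `(−s)`-eigen modulo `q·𝓛_λ`
# pairs to ZERO with every `s`-eigen class killed by `q` — the local term of the Cassels–Tate pairing between Kolyvagin classes of
# OPPOSITE depth parity (socket X-ORTH of `Lines/plus-descent-deep-orthogonality-gk2p4.md`)

Seat `bsd-line-gk2-p4` g20 (WIDTH-5 attach, cell `bsd-f1-sign2`), `--supports` the crux L_T (helper; closes nothing).  THEOREMS ONLY (no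
definition, no named fact, no `sorry`); BSD is not proved by any of this; neither is L_T nor any stub.

WHY.  The K-side count `…RTOrthogonalLadders` (p735742) turns L_T into X-ORTH: the Cassels–Tate pairing `B(ι z_n, ι z_{n′})` between a
(+)-rung and a (−)-rung Kolyvagin Ш-class vanishes.  McCallum's Prop. 4.7 in the tree's form (`ctGeneralFun_zsmul_eq_value`,
`sum_localTerm_eq_value`) writes it as a sum of local terms `inv_v((res_v b₁ − β_v) ∪ β′_v)` over ANY first-case datum, with `z_n = q • b₁`,
`β_v, β′_v ∈ 𝓛_v` Kummer lifts and `mulK β′_v = res_v b′`, `b′` the level-`q` preimage of `z_{n′}` (opposite sign).  At a CROSS place `λ ∣ n`,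
`ℓ ∤ n′` the lift `β′_λ` is `(−s)`-eigen only MODULO `ker(mulK) ∩ 𝓛 = q·𝓛`, and `res_λ b₁` is `s`-eigen with `q • res_λ b₁ = res_λ z_n = 0`
(own prime of the Ш-class).  This file proves that such a term vanishes, for EVERY lift:
* §1 (abstract, the dialect of `…RTInvariantLostBit`): in a free rank-one `ℤ/2^M[τ]`-module on `a₀`, **`τw + s·w = q·w′ ⟹
  w = b·(τa₀ − s·a₀) + q·(c·a₀)`** (`exists_eq_conorm_add_zsmul_of_tau_add_zsmul_eq`); hence for an invariant pairing `P(τ·, σ·) = P`,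
  `σy = s·y` and `q·y = 0` ⟹ **`P(w, y) = 0`** (`pairing_eq_zero_of_tau_add_zsmul_eq`).  At `q = 0` this is gk2-p3's
  `pairing_eq_zero_of_opposite_signs`; no hypothesis on `s` is needed.
* §2 (displayed local structure, the dialect of `…RTLocalEigenDuality` §1): `Y, Y′ ∈ 𝓛_v`, `σY + s·Y = q·Y′`, `σX = s·X`, `q·X = 0` ⟹
  **`inv_v(Y ∪ₑ X) = 0 = inv_v(X ∪ₑ Y)`** (`invWeilPairing_kummer_eq_zero_of_conj_add_zsmul_eq`, `…_right_…`).
* §3 (assembled on the route's frame, as gk2-p3's `addOrderOf_invWeilPairing_localization_eq_of_same_sign`): `K` imaginary quadratic,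
  `τ ≠ 1`, `τ² = 1`; `E/ℚ` globally minimal, `Δ < 0`; `ℓ` a Zhang–Kolyvagin prime at `2` with `1 ≤ M ≤ M(ℓ)` AND `FrobEqFrobInfty W K (2^M) ℓ`
  (regularity is NECESSARY: if `Frob_ℓ = id` on `E[2]` nothing vanishes); `λ ∋ ℓ`, `τ•λ = λ`; `e` a Weil datum equivariant for the adapted lift,
  `inv` conj-compatible (the canonical family is: `isConjCompatible_canonical`).  For a global `x` with `τ_* x = s·x`, `q·loc_λ x = 0`, and local
  `Y, Y′ ∈ 𝓛_λ` with `σ_*Y + s·Y = q·Y′`:  **`inv_λ(Y ∪ₑ loc_λ x) = 0 ∧ inv_λ(loc_λ x ∪ₑ Y) = 0`**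
  (`invWeilPairing_kummer_localization_eq_zero_of_conjActPlace_add_zsmul_eq`); `q = 0`: `…_of_opposite_signs` (the assembled form of
  `…RTLocalEigenDuality.invWeilPairing_unr_eq_zero_of_opposite_signs`).
SAME-sign terms lose the known bit (gk2-p3); CROSS-sign terms lose nothing — they are zero; this is why orthogonality (not disjointness) of
the two Kolyvagin spans is what the Euler system supplies at `p = 2`.

References: [McCallumLMS1991] §4 Prop. 4.7, §5 Lemma 5.3 (odd `p`: «different eigenspaces are orthogonal»); [Howard2004HeegnerKolyvagin]
Lemma 1.5.3; [MilneADT2006] I §6 proof of Prop. 6.9 (the local terms); [Kolyvagin1991StructureSha].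
-/

set_option autoImplicit false

noncomputable section

open scoped Classical
open Function Field NumberField IsDedekindDomain WeierstrassCurve
open Literature.NumberTheory.EllipticCurves Literature.NumberTheory.GaloisRepresentations
open Literature.NumberTheory.GaloisCohomology
open Literature.NumberTheory.Automorphic
open Summit.BirchSwinnertonDyer.Rank1Residual.X11b.Relaxation
open Summit.BirchSwinnertonDyer.Rank1Residual.JET.GlobalDuality

-- the Theorems namespace of this sub repeats the summit name by design (D-0017 nested layout)
set_option linter.dupNamespace false

namespace Summit.BirchSwinnertonDyer.BirchSwinnertonDyer.Theorems.GenusExact.PlusDescent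

/-! ## §1 Abstract: eigen-modulo-`q` vectors of a regular module pair to zero with `q`-torsion eigenvectors of the same `σ`-sign -/

section Law

variable {A B R : Type*} [AddCommGroup A] [AddCommGroup B] [AddCommGroup R]
  (τ : A →+ A) (hτ : ∀ x, τ (τ x) = x) (σ : B →+ B) (hσ : ∀ y, σ (σ y) = y)
  (P : A →+ B →+ R) (hinv : ∀ x y, P (τ x) (σ y) = P x y)
  {M : ℕ} (a₀ : A)
  (hspan : ∀ Q : A, ∃ a b : ℤ, Q = a • a₀ + b • τ a₀)
  (hfree : ∀ a b : ℤ, a • a₀ + b • τ a₀ = 0 → (2 ^ M : ℤ) ∣ a ∧ (2 ^ M : ℤ) ∣ b)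
  (htor : (2 ^ M : ℤ) • a₀ = 0)

include hτ hspan hfree htor in
/-- **Eigen modulo `q` ⟹ conorm modulo `q`.**  In a free rank-one `ℤ/2^M[τ]`-module on `a₀` (`E[2^M]` on `Δ < 0`, route item Q1): if
`τw + s·w = q·w′` then `w = b·(τa₀ − s·a₀) + q·(c·a₀)` for some integers `b, c` (coordinates: `w = a·a₀ + b·τa₀` gives
`2^M ∣ a + sb − q c`). [folklore; cite: McCallumLMS1991, §3 (the ⟨τ⟩-basis of E[p^M])] -/
theorem exists_eq_conorm_add_zsmul_of_tau_add_zsmul_eq {s q : ℤ} {w w' : A} (hw : τ w + s • w = q • w') :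
    ∃ b c : ℤ, w = b • (τ a₀ - s • a₀) + q • (c • a₀) := by
  obtain ⟨a, b, rfl⟩ := hspan w
  obtain ⟨a', b', hw'⟩ := hspan w'
  -- the relation `τw + sw − qw′ = 0` in coordinates
  have hrel : (b + s * a - q * a') • a₀ + (a + s * b - q * b') • τ a₀ = 0 := by
    have h : τ (a • a₀ + b • τ a₀) + s • (a • a₀ + b • τ a₀) - q • w' = 0 := by rw [hw, sub_self]
    rw [hw', map_add, map_zsmul, map_zsmul, hτ] at h
    rw [← h]
    module
  obtain ⟨-, ⟨k, hk⟩⟩ := hfree _ _ hrel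
  refine ⟨b, b', ?_⟩
  have ha : a = q * b' - s * b + k * 2 ^ M := by linear_combination hk
  have hk0 : (k * 2 ^ M) • a₀ = 0 := by rw [mul_smul, htor, smul_zero]
  rw [ha, add_smul, hk0, add_zero]
  module

include hτ hσ hinv hspan hfree htor in
/-- **Cross-sign vanishing modulo `q` (abstract).**  `P : A × B → R` bi-additive with `P(τa, σb) = P(a, b)`, `A` free of rank one over
`ℤ/2^M[τ]` on `a₀`, `σ` an involution.  If `τw + s·w = q·w′` (the `A`-side vector is `(−s)`-eigen MODULO `q`), `σy = s·y` and `q·y = 0`,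
then `P(w, y) = 0`: `w = b(τa₀ − s a₀) + q c a₀`, `P(τa₀ − s a₀, y) = P(a₀, σy) − s P(a₀, y) = 0`, `P(q c a₀, y) = P(c a₀, q y) = 0`.  For
`q = 0` this is `…RTInvariantLostBit.pairing_eq_zero_of_opposite_signs`. [cite: McCallumLMS1991, §5 Lemma 5.3]
[cite: Howard2004HeegnerKolyvagin, Lemma 1.5.3] -/
theorem pairing_eq_zero_of_tau_add_zsmul_eq {s q : ℤ} {w w' : A} (hw : τ w + s • w = q • w') {y : B} (hy : σ y = s • y)
    (hqy : q • y = 0) : P w y = 0 := by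
  obtain ⟨b, c, rfl⟩ := exists_eq_conorm_add_zsmul_of_tau_add_zsmul_eq τ hτ a₀ hspan hfree htor hw
  have h1 : P (τ a₀ - s • a₀) y = 0 := by
    rw [map_sub, AddMonoidHom.sub_apply, pairing_tau_left_of_invariant τ σ hσ P hinv, hy, map_zsmul, map_zsmul,
      AddMonoidHom.zsmul_apply, sub_self]
  have h2 : P (q • (c • a₀)) y = 0 := by
    rw [map_zsmul, AddMonoidHom.zsmul_apply, ← map_zsmul, hqy, map_zero]
  rw [map_add, AddMonoidHom.add_apply, map_zsmul, AddMonoidHom.zsmul_apply, h1, zsmul_zero, zero_add, h2]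

end Law

/-! ## §2 Displayed local structure: a Kummer class `(−s)`-eigen modulo `q·𝓛_v` against an `s`-eigenclass killed by `q` -/

section Structure

variable {K : Type} [Field K] [NumberField K] (W : WeierstrassCurve K) [W.IsElliptic] (M : ℕ)
variable (e : W.geomTorsion ((2 ^ M : ℕ) : ℤ) → W.geomTorsion ((2 ^ M : ℕ) : ℤ) → AlgebraicClosure K)
  (hμ : ∀ S T, e S T ^ (2 ^ M) = 1)
  (hadd₁ : ∀ S₁ S₂ T, e (S₁ + S₂) T = e S₁ T * e S₂ T)
  (hadd₂ : ∀ S T₁ T₂, e S (T₁ + T₂) = e S T₁ * e S T₂)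
  (hgal : ∀ (γ : absoluteGaloisGroup K) (S T : W.geomTorsion ((2 ^ M : ℕ) : ℤ)), γ • e S T = e (γ • S) (γ • T))
  (halt : ∀ T, e T T = 1)
  (v : HeightOneSpectrum (𝓞 K)) (inv : LocalInvariants K (2 ^ M))

variable {T : Type*} [AddCommGroup T] (t : T →+ T) (ht : ∀ Q, t (t Q) = Q)
  (σ : galoisCohomology ((W.torsionGaloisModule ((2 ^ M : ℕ) : ℤ)).toLocal (Sum.inr v)) 1 →+
    galoisCohomology ((W.torsionGaloisModule ((2 ^ M : ℕ) : ℤ)).toLocal (Sum.inr v)) 1)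
  (hσ : ∀ X, σ (σ X) = X)
  (hσb : ∀ X Y, invWeilPairing W (2 ^ M) e hμ hadd₁ hadd₂ hgal inv (Sum.inr v) (σ X) (σ Y) =
    invWeilPairing W (2 ^ M) e hμ hadd₁ hadd₂ hgal inv (Sum.inr v) X Y)
  (unr : T →+ galoisCohomology ((W.torsionGaloisModule ((2 ^ M : ℕ) : ℤ)).toLocal (Sum.inr v)) 1)
  (hunr : ∀ Q, unr (t Q) = σ (unr Q))
  (hLunr : ∀ Y ∈ W.kummerSelmerStructure ((2 ^ M : ℕ) : ℤ) (Sum.inr v), ∃ Q, unr Q = Y)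
  (hunr0 : Injective unr)
  (P₁ : T)
  (hspan : ∀ Q : T, ∃ a b : ℤ, Q = a • P₁ + b • t P₁)
  (hfree : ∀ a b : ℤ, a • P₁ + b • t P₁ = 0 → (2 ^ M : ℤ) ∣ a ∧ (2 ^ M : ℤ) ∣ b)
  (htor : (2 ^ M : ℤ) • P₁ = 0)

omit [W.IsElliptic] in
include ht hσ hσb hunr hLunr hunr0 hspan hfree htor in
/-- **Cross-sign vanishing modulo `q` (displayed structure).**  In the setting of `…RTLocalEigenDuality` §1 (`σ` an involution of
`H = H¹(K_v, E[2^M])` preserving `inv_v(· ∪ₑ ·)`, `𝓛_v = unr(T)` equivariantly, `T` free of rank one over `ℤ/2^M[t]` on `P₁`): for Kummer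
classes `Y, Y′ ∈ 𝓛_v` with `σY + s·Y = q·Y′` and a local class `X` with `σX = s·X`, `q·X = 0`:  **`inv_v(Y ∪ₑ X) = 0`**.
(McCallum 4.7's cross local term: `Y = β′_λ` a Kummer lift, `(−s)`-eigen only modulo `ker mulK ∩ 𝓛 = q𝓛`; `X = res_λ b₁`, `q X = res_λ z = 0`.)
[cite: McCallumLMS1991, §4 Prop. 4.7, §5 Lemma 5.3] [cite: Howard2004HeegnerKolyvagin, Lemma 1.5.3] -/
theorem invWeilPairing_kummer_eq_zero_of_conj_add_zsmul_eq {s q : ℤ}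
    {Y Y' X : galoisCohomology ((W.torsionGaloisModule ((2 ^ M : ℕ) : ℤ)).toLocal (Sum.inr v)) 1}
    (hY : Y ∈ W.kummerSelmerStructure ((2 ^ M : ℕ) : ℤ) (Sum.inr v)) (hY' : Y' ∈ W.kummerSelmerStructure ((2 ^ M : ℕ) : ℤ) (Sum.inr v))
    (hσY : σ Y + s • Y = q • Y') (hX : σ X = s • X) (hqX : q • X = 0) :
    invWeilPairing W (2 ^ M) e hμ hadd₁ hadd₂ hgal inv (Sum.inr v) Y X = 0 := by
  set b := invWeilPairing W (2 ^ M) e hμ hadd₁ hadd₂ hgal inv (Sum.inr v) with hb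
  obtain ⟨w, rfl⟩ := hLunr Y hY
  obtain ⟨w', rfl⟩ := hLunr Y' hY'
  have hw : t w + s • w = q • w' := by
    apply hunr0
    rw [map_add, map_zsmul, map_zsmul, hunr, hσY]
  have hinv' : ∀ (x : T) (y : galoisCohomology ((W.torsionGaloisModule ((2 ^ M : ℕ) : ℤ)).toLocal (Sum.inr v)) 1),
      (b.comp unr) (t x) (σ y) = (b.comp unr) x y := fun x y ↦ by
    rw [AddMonoidHom.comp_apply, AddMonoidHom.comp_apply, hunr, hσb]
  have key := pairing_eq_zero_of_tau_add_zsmul_eq t ht σ hσ (b.comp unr) hinv' P₁ hspan hfree htor hw hX hqX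
  rwa [AddMonoidHom.comp_apply] at key

omit [W.IsElliptic] in
include halt ht hσ hσb hunr hLunr hunr0 hspan hfree htor in
/-- The same with the Kummer class in the second slot: **`inv_v(X ∪ₑ Y) = 0`** (symmetry of `inv_v(· ∪ₑ ·)`, `invWeilPairing_comm`).
[cite: McCallumLMS1991, §4 Prop. 4.7, §5 Lemma 5.3] -/
theorem invWeilPairing_kummer_right_eq_zero_of_conj_add_zsmul_eq {s q : ℤ}
    {Y Y' X : galoisCohomology ((W.torsionGaloisModule ((2 ^ M : ℕ) : ℤ)).toLocal (Sum.inr v)) 1}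
    (hY : Y ∈ W.kummerSelmerStructure ((2 ^ M : ℕ) : ℤ) (Sum.inr v)) (hY' : Y' ∈ W.kummerSelmerStructure ((2 ^ M : ℕ) : ℤ) (Sum.inr v))
    (hσY : σ Y + s • Y = q • Y') (hX : σ X = s • X) (hqX : q • X = 0) :
    invWeilPairing W (2 ^ M) e hμ hadd₁ hadd₂ hgal inv (Sum.inr v) X Y = 0 := by
  rw [invWeilPairing_comm W M e hμ hadd₁ hadd₂ hgal halt v inv X Y]
  exact invWeilPairing_kummer_eq_zero_of_conj_add_zsmul_eq W M e hμ hadd₁ hadd₂ hgal v inv t ht σ hσ hσb unr hunr hLunr hunr0 P₁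
    hspan hfree htor hY hY' hσY hX hqX

end Structure

/-! ## §3 Assembled at a deep inert Kolyvagin place of the Heegner field -/

section Kolyvagin

variable (W : WeierstrassCurve ℚ) (K : Type) [Field K] [NumberField K] [W.IsElliptic] [W.IsGloballyMinimal]

/-- **THE CROSS-SIGN LOCAL VANISHING AT A DEEP INERT KOLYVAGIN PLACE, modulo `q` (assembled).**  `K` imaginary quadratic with `τ ≠ 1`,
`τ² = 1`; `E/ℚ` globally minimal, `Δ < 0`; `ℓ` a Zhang–Kolyvagin prime at `2` with `1 ≤ M ≤ M(ℓ)` and `FrobEqFrobInfty W K (2^M) ℓ` (so that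
`E[2^M]` is the REGULAR `⟨τ̃_*⟩`-module — necessary); `λ ∋ ℓ`, `τ•λ = λ`; `e` a Weil datum on `E_K[2^M]` equivariant for the adapted lift,
`inv` conj-compatible.  For a GLOBAL class `x` with `τ_* x = s·x` whose localisation is killed by `q`, and LOCAL Kummer classes
`Y, Y′ ∈ 𝓛_λ` with `σ_*Y + s·Y = q·Y′` (`σ_* = conjActPlace`):  **`inv_λ(Y ∪ₑ loc_λ x) = 0` and `inv_λ(loc_λ x ∪ₑ Y) = 0`.**  This is the
local term of the Cassels–Tate pairing between Kolyvagin classes of OPPOSITE depth parity at a prime of the first one (`x = b₁`,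
`q = 2^k`, `Y = β′_λ`). [cite: McCallumLMS1991, §4 Prop. 4.7, §5 Lemma 5.3] [cite: GrossLMS1991, §3 (3.2)] [cite: Howard2004HeegnerKolyvagin, Lemma 1.5.3] -/
theorem invWeilPairing_kummer_localization_eq_zero_of_conjActPlace_add_zsmul_eq (hK : IsImaginaryQuadratic K) (hΔ : W.Δ < 0)
    {M ℓ : ℕ} (hM : 1 ≤ M)
    (hℓ : Zhang2014.IsKolyvaginPrime (W.conductorNorm ℤ) W K 2 ℓ) (hk : M ≤ Zhang2014.kolyvaginIndex W 2 ℓ)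
    (hF : FrobEqFrobInfty W K (2 ^ M) ℓ) (w : HeightOneSpectrum (𝓞 K)) (hw : (ℓ : 𝓞 K) ∈ w.asIdeal)
    {τ : K ≃ₐ[ℚ] K} (hτ1 : τ ≠ 1) (hττ : τ * τ = 1) (hfix : τ • w = w)
    (e : (W.baseChange K).geomTorsion ((2 ^ M : ℕ) : ℤ) → (W.baseChange K).geomTorsion ((2 ^ M : ℕ) : ℤ) → AlgebraicClosure K)
    (hμ : ∀ S T, e S T ^ (2 ^ M) = 1)
    (hadd₁ : ∀ S₁ S₂ T, e (S₁ + S₂) T = e S₁ T * e S₂ T)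
    (hadd₂ : ∀ S T₁ T₂, e S (T₁ + T₂) = e S T₁ * e S T₂)
    (hgal : ∀ (γ : absoluteGaloisGroup K) (S T : (W.baseChange K).geomTorsion ((2 ^ M : ℕ) : ℤ)), γ • e S T = e (γ • S) (γ • T))
    (halt : ∀ T, e T T = 1)
    (hte : ∀ S T, e ((isLiftOfAut_liftAutPlace τ hfix).torsionMap W ((2 ^ M : ℕ) : ℤ) S)
      ((isLiftOfAut_liftAutPlace τ hfix).torsionMap W ((2 ^ M : ℕ) : ℤ) T) = liftAutPlace τ hfix (e S T))
    (inv : LocalInvariants K (2 ^ M)) (hinvc : inv.IsConjCompatible τ)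
    {x : galoisCohomology ((W.baseChange K).torsionGaloisModule ((2 ^ M : ℕ) : ℤ)) 1} {s q : ℤ}
    (hx : conjAct W τ ((2 ^ M : ℕ) : ℤ) x = s • x)
    (hqx : q • galoisCohomology.localization ((W.baseChange K).torsionGaloisModule ((2 ^ M : ℕ) : ℤ)) (Sum.inr w : Place K) 1 x = 0)
    {Y Y' : galoisCohomology (((W.baseChange K).torsionGaloisModule ((2 ^ M : ℕ) : ℤ)).toLocal (Sum.inr w : Place K)) 1}
    (hY : Y ∈ (W.baseChange K).kummerSelmerStructure ((2 ^ M : ℕ) : ℤ) (Sum.inr w))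
    (hY' : Y' ∈ (W.baseChange K).kummerSelmerStructure ((2 ^ M : ℕ) : ℤ) (Sum.inr w))
    (hσY : conjActPlace W τ ((2 ^ M : ℕ) : ℤ) hfix Y + s • Y = q • Y') :
    invWeilPairing (W.baseChange K) (2 ^ M) e hμ hadd₁ hadd₂ hgal inv (Sum.inr w) Y
        (galoisCohomology.localization ((W.baseChange K).torsionGaloisModule ((2 ^ M : ℕ) : ℤ)) (Sum.inr w : Place K) 1 x) = 0 ∧
      invWeilPairing (W.baseChange K) (2 ^ M) e hμ hadd₁ hadd₂ hgal inv (Sum.inr w)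
        (galoisCohomology.localization ((W.baseChange K).torsionGaloisModule ((2 ^ M : ℕ) : ℤ)) (Sum.inr w : Place K) 1 x) Y = 0 := by
  set loc := galoisCohomology.localization ((W.baseChange K).torsionGaloisModule ((2 ^ M : ℕ) : ℤ)) (Sum.inr w : Place K) 1
    with hloc
  set σ := conjActPlace W τ ((2 ^ M : ℕ) : ℤ) hfix with hσdef
  set t := (isLiftOfAut_liftAutPlace τ hfix).torsionMap W ((2 ^ M : ℕ) : ℤ) with htdef
  -- good reduction and `2 ∉ λ`
  obtain ⟨hgood, hpw⟩ := hasGoodReductionAt_of_zhangKolyvaginPrime W K hℓ w hw 1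
  have hpw' : ((2 : ℕ) : 𝓞 K) ∉ w.asIdeal := by rwa [pow_one, Int.cast_natCast] at hpw
  -- the `τ`-structure: `σ` involutive and preserving the pairing
  have hσ : ∀ X, σ (σ X) = X := fun X ↦ conjActPlace_conjActPlace_self W τ (2 ^ M) hττ hfix X
  have hσb := invWeilPairing_conjActPlace_self W τ (2 ^ M) e hμ hadd₁ hadd₂ hgal hfix hte inv hinvc
  -- the unramified parametrisation and the regular frame
  obtain ⟨unr, hunr0, -, hLunr, hunr⟩ :=
    exists_unramified_parametrization_kummer W K hK hℓ hk w hw hpw' hgood τ hfix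
  obtain ⟨Q₀, htor, hspan, hfree, ht⟩ := exists_regular_frame_liftAutPlace W K hK hΔ hM hℓ hk hF w hw hτ1 hfix
  -- the localisation of the global `s`-eigenclass is a `σ`-eigenclass of sign `s`
  have hX : σ (loc x) = s • loc x := by
    rw [hσdef, hloc, conjActPlace_localization_self W τ (2 ^ M) hfix x, hx, map_zsmul]
  have h1 := invWeilPairing_kummer_eq_zero_of_conj_add_zsmul_eq (W.baseChange K) M e hμ hadd₁ hadd₂ hgal w inv t ht σ hσ hσb unr
    hunr hLunr hunr0 Q₀ hspan hfree htor hY hY' hσY hX hqx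
  exact ⟨h1, by rw [invWeilPairing_comm (W.baseChange K) M e hμ hadd₁ hadd₂ hgal halt w inv]; exact h1⟩

/-- **Opposite signs pair to zero at a deep inert Kolyvagin place (assembled; `q = 0`).**  Same frame; `τ_* x = s·x` global,
`Y ∈ 𝓛_λ` local with `σ_*Y = −(s·Y)`:  `inv_λ(Y ∪ₑ loc_λ x) = 0` and `inv_λ(loc_λ x ∪ₑ Y) = 0` — the assembled form of
`…RTLocalEigenDuality.invWeilPairing_unr_eq_zero_of_opposite_signs` (no displayed local structure left).
[cite: McCallumLMS1991, §5 Lemma 5.3] [cite: Howard2004HeegnerKolyvagin, Lemma 1.5.3] -/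
theorem invWeilPairing_kummer_localization_eq_zero_of_opposite_signs (hK : IsImaginaryQuadratic K) (hΔ : W.Δ < 0)
    {M ℓ : ℕ} (hM : 1 ≤ M)
    (hℓ : Zhang2014.IsKolyvaginPrime (W.conductorNorm ℤ) W K 2 ℓ) (hk : M ≤ Zhang2014.kolyvaginIndex W 2 ℓ)
    (hF : FrobEqFrobInfty W K (2 ^ M) ℓ) (w : HeightOneSpectrum (𝓞 K)) (hw : (ℓ : 𝓞 K) ∈ w.asIdeal)
    {τ : K ≃ₐ[ℚ] K} (hτ1 : τ ≠ 1) (hττ : τ * τ = 1) (hfix : τ • w = w)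
    (e : (W.baseChange K).geomTorsion ((2 ^ M : ℕ) : ℤ) → (W.baseChange K).geomTorsion ((2 ^ M : ℕ) : ℤ) → AlgebraicClosure K)
    (hμ : ∀ S T, e S T ^ (2 ^ M) = 1)
    (hadd₁ : ∀ S₁ S₂ T, e (S₁ + S₂) T = e S₁ T * e S₂ T)
    (hadd₂ : ∀ S T₁ T₂, e S (T₁ + T₂) = e S T₁ * e S T₂)
    (hgal : ∀ (γ : absoluteGaloisGroup K) (S T : (W.baseChange K).geomTorsion ((2 ^ M : ℕ) : ℤ)), γ • e S T = e (γ • S) (γ • T))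
    (halt : ∀ T, e T T = 1)
    (hte : ∀ S T, e ((isLiftOfAut_liftAutPlace τ hfix).torsionMap W ((2 ^ M : ℕ) : ℤ) S)
      ((isLiftOfAut_liftAutPlace τ hfix).torsionMap W ((2 ^ M : ℕ) : ℤ) T) = liftAutPlace τ hfix (e S T))
    (inv : LocalInvariants K (2 ^ M)) (hinvc : inv.IsConjCompatible τ)
    {x : galoisCohomology ((W.baseChange K).torsionGaloisModule ((2 ^ M : ℕ) : ℤ)) 1} {s : ℤ}
    (hx : conjAct W τ ((2 ^ M : ℕ) : ℤ) x = s • x)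
    {Y : galoisCohomology (((W.baseChange K).torsionGaloisModule ((2 ^ M : ℕ) : ℤ)).toLocal (Sum.inr w : Place K)) 1}
    (hY : Y ∈ (W.baseChange K).kummerSelmerStructure ((2 ^ M : ℕ) : ℤ) (Sum.inr w))
    (hσY : conjActPlace W τ ((2 ^ M : ℕ) : ℤ) hfix Y = -(s • Y)) :
    invWeilPairing (W.baseChange K) (2 ^ M) e hμ hadd₁ hadd₂ hgal inv (Sum.inr w) Y
        (galoisCohomology.localization ((W.baseChange K).torsionGaloisModule ((2 ^ M : ℕ) : ℤ)) (Sum.inr w : Place K) 1 x) = 0 ∧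
      invWeilPairing (W.baseChange K) (2 ^ M) e hμ hadd₁ hadd₂ hgal inv (Sum.inr w)
        (galoisCohomology.localization ((W.baseChange K).torsionGaloisModule ((2 ^ M : ℕ) : ℤ)) (Sum.inr w : Place K) 1 x) Y = 0 := by
  have hσY' : conjActPlace W τ ((2 ^ M : ℕ) : ℤ) hfix Y + s • Y = (0 : ℤ) • (0 : _) := by rw [hσY, neg_add_cancel, zero_smul]
  exact invWeilPairing_kummer_localization_eq_zero_of_conjActPlace_add_zsmul_eq W K hK hΔ hM hℓ hk hF w hw hτ1 hττ hfix e hμ hadd₁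
    hadd₂ hgal halt hte inv hinvc hx (by rw [zero_smul]) hY (AddSubgroup.zero_mem _) hσY'

end Kolyvagin

end Summit.BirchSwinnertonDyer.BirchSwinnertonDyer.Theorems.GenusExact.PlusDescent

end
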